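import Literature.AlgebraicGeometry.Motives.FrobeniusMorphism
import Mathlib.CategoryTheory.Monoidal.Cartesian.Over
import Mathlib.CategoryTheory.Monoidal.Grp
import HarnessLib

/-!
# The relative `q`-Frobenius `F_{X/S} : X → X^{(q/S)}` over a base scheme `S` of characteristic `p`, and its
# compatibility with group structures (SGA 3 VII_A §4; Görtz–Wedhorn (4.24))

Topic `AlgebraicGeometry/GroupSchemes`; namespace `Literature.AlgebraicGeometry.GroupSchemes.RelFrobenius`.
DEFINITIONS WITH BODIES and fully proved theorems: **no named fact, no `sorry`, no instance, no notation**.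
Cell `pub/hodgecm-mathlib`, programme P6 («MOD»), organ (O3) of the P6c census (`secFrob` as a morphism: «the
kernel of the `q`-Frobenius of `𝒢̄` over the special fibre»), file (O3a).

## Mathematics

Let `k = 𝔽_q` be a finite field and `S` a `k`-scheme; write `F_S : S → S` for its `k`-linear `q`-Frobenius
(identity on points, `s ↦ s^q` on functions; the tree's `frobeniusOver`).  For an `S`-scheme `X → S` the
**Frobenius twist** is the base change `X^{(q/S)} := X ×_{S, F_S} S → S` (second projection) and the **relative
Frobenius** `F_{X/S} : X → X^{(q/S)}` is the `S`-morphism with components the absolute `q`-Frobenius `F_X` of `X`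
and the structure map (they agree over `S` because EVERY morphism commutes with the `q`-power maps,
`F_X ≫ (X → S) = (X → S) ≫ F_S`).  `X ↦ X^{(q/S)}` is the (cartesian monoidal) base-change functor
`Over.pullback F_S`, so for an `S`-GROUP scheme `G` the twist `G^{(q/S)}` is an `S`-group scheme (Mathlib's
transported structure `Functor.grpObjObj`) and **`F_{G/S}` is a homomorphism of `S`-group schemes**: units and
multiplications are morphisms of schemes, hence commute with the absolute Frobenius, and the two sides of each
axiom agree after projecting to `G` [SGA3 VII_A 4.1; Görtz–Wedhorn (4.24) for the scheme part].  The tree's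
`Motives/AbelianVarietyFrobeniusTwistVariety` (B-p12) has the DIFFERENT special case «base `Spec k`, twist along
`Spec Frobⁿ` for an arbitrary field `k` and `q = pⁿ`» (`frobeniusTwistOver`, `relFrobeniusOver`); here the base is an
arbitrary `𝔽_q`-scheme `S` and the twist is along ITS Frobenius `F_S` (for `S = Spec 𝔽_q` itself `F_S = 𝟙` and
`X^{(q/S)} ≅ X`) — the proof pattern (projections + naturality of `powEndo`) is the same and is credited to that file.

## Contents (`k` finite, `S : SchemeOver k`, `X Y T : Over S.left`)
* §1 `absFrob S X : X.left ⟶ X.left` (the absolute `q`-Frobenius of the underlying scheme, through the tree's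
  `frobeniusOver` of `X` as a `k`-scheme), `absFrob_comp_left` (naturality), `absFrob_comp_hom`.
* §2 `frobTwist S X` (`X^{(q/S)}`, an `abbrev` for `(Over.pullback (frobeniusOver S).left).obj X`), `twistFst`,
  `twistFst_comp_hom`, `twist_hom_ext`, `frobTwist_hom_ext`; **`relFrobenius S X : X ⟶ frobTwist S X`**,
  `relFrobenius_left_comp_twistFst` (`F_{X/S} ≫ pr = F_X`), `twistFst_relFrobenius_apply` (identity on points),
  `pullback_map_left_comp_twistFst`, `comp_relFrobenius_left_comp_twistFst`, **`relFrobenius_comp_map`**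
  (naturality `F_{X/S} ≫ f^{(q)} = f ≫ F_{Y/S}`).
* §3 the unit and the tensorator of `Over.pullback F_S` against `twistFst` (`absFrob_tensorUnit`,
  `ε_left_comp_twistFst`, `tensorHom_μ_left_comp_twistFst`).
* §4 for `[GrpObj G]` (with `open scoped CategoryTheory.Obj`, which equips `G^{(q/S)}` with Mathlib's transported
  group structure): `one_comp_relFrobenius`, `mul_comp_relFrobenius`, **`isMonHom_relFrobenius`**.

What is deliberately NOT here: the kernel `Ker F_{G/S}` (file (O3b), over ★ `GroupSchemeKernel`), its finiteness ∕
flatness ∕ rank `q^{dim}` for abelian schemes (O3c), iterates `F^r`, the Verschiebung, base change of the twist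
along `S′ → S`.  HC_CM is proved only modulo the printed citations until rung 0 closes; this file changes no count.

## References
* [SGA3I] M. Demazure, A. Grothendieck (eds.), *SGA 3, Tome I*, Exp. VII_A (P. Gabriel), §4 «Frobeniuseries»,
  4.1 (`X^{(p)}`, `F_{X/S}`, functoriality, compatibility with products and group structures).
* [GortzWedhorn2020] U. Görtz, T. Wedhorn, *Algebraic Geometry I* (2nd ed.), Def.∕Rem. 4.24 (relative Frobenius
  over a base `S` of characteristic `p`), Section (4.7) (base change).
* [Milne2025] J. S. Milne, *Étale cohomology*, VI §13 Rem. 13.5 (relative Frobenius).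
-/

set_option autoImplicit false

noncomputable section

-- Compositions through `((Over.pullback f).obj X).left = pullback X.hom f`, `(X ⊗ Y).left = pullback X.hom Y.hom`
-- are definitional only above `instances` transparency (as in Mathlib's `CategoryTheory.Over.pullback` ∕
-- `Monoidal.Cartesian.Over` API itself, and the tree's `Motives/AbelianVarietyFrobeniusTwistVariety`).
set_option backward.isDefEq.respectTransparency false

universe u

open CategoryTheory CategoryTheory.Limits AlgebraicGeometry MonoidalCategory

namespace Literature.AlgebraicGeometry.GroupSchemes.RelFrobenius

open Literature.AlgebraicGeometry.Motives

variable {k : Type u} [Field k] [Finite k] (S : SchemeOver k)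

/-! ## §1 The absolute `q`-Frobenius of an `S`-scheme -/

section Absolute

variable (X : Over S.left)

/-- An `S`-scheme `X → S`, `S` a `k`-scheme, read as a `k`-scheme through `X → S → Spec k`.
[cite: GortzWedhorn2020, Section (4.7)] -/
abbrev overField : SchemeOver k := Over.mk (X.hom ≫ S.hom)

/-- **The absolute `q`-Frobenius `F_X` of the scheme underlying an `S`-scheme `X`** (`q = #k`): the identity on
points and `s ↦ s^q` on `𝒪_X` — the underlying morphism of the tree's `k`-linear Frobenius `frobeniusOver` of `X`
read as a `k`-scheme. [cite: GortzWedhorn2020, Def. 4.24] -/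
abbrev absFrob : X.left ⟶ X.left := (frobeniusOver (overField S X)).left

/-- `F_X` is the `q`-power endomorphism `powEndo` (by `rfl`). [cite: GortzWedhorn2020, Def. 4.24] -/
theorem absFrob_eq_powEndo :
    absFrob S X = powEndo X.left (Nat.card k) card_ne_zero (add_pow_card_sections (overField S X)) := rfl

variable {X} in
/-- **Naturality of the absolute Frobenius**: every morphism of schemes `g : T → X` (here between the underlying
schemes of two `S`-schemes, not necessarily over `S`) satisfies `F_T ≫ g = g ≫ F_X`. [cite: GortzWedhorn2020, Def. 4.24] -/
@[reassoc]
theorem absFrob_comp_left {T : Over S.left} (g : T.left ⟶ X.left) : absFrob S T ≫ g = g ≫ absFrob S X :=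
  powEndo_comp _ _ _ g _

/-- **`F_X` covers `F_S`**: `F_X ≫ (X → S) = (X → S) ≫ F_S`. [cite: GortzWedhorn2020, Def. 4.24] -/
@[reassoc]
theorem absFrob_comp_hom : absFrob S X ≫ X.hom = X.hom ≫ (frobeniusOver S).left :=
  powEndo_comp _ _ _ X.hom _

/-- On the base itself (the terminal `S`-scheme `S → S`), `F` is `F_S`. [cite: GortzWedhorn2020, Def. 4.24] -/
theorem absFrob_tensorUnit : absFrob S (𝟙_ (Over S.left)) = (frobeniusOver S).left := rfl

end Absolute

/-! ## §2 The Frobenius twist `X^{(q/S)}` and the relative Frobenius `F_{X/S}` -/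

section Twist

variable (X : Over S.left)

/-- **The Frobenius twist `X^{(q/S)} = X ×_{S, F_S} S → S`** (structure map = second projection): Mathlib's
base change `Over.pullback F_S` applied to `X`, an `abbrev` so that the cartesian-monoidal structure of
`Over.pullback` is found by unification. [cite: SGA3I, VII_A 4.1] -/
abbrev frobTwist : Over S.left := (Over.pullback (frobeniusOver S).left).obj X

/-- The projection `pr_X : X^{(q/S)} → X` (it is `pullback.fst`; the wrapper pins the syntactic form of the source).
[cite: SGA3I, VII_A 4.1] -/
def twistFst : (frobTwist S X).left ⟶ X.left := pullback.fst X.hom (frobeniusOver S).left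

/-- `twistFst` is the first projection (by definition). [cite: GortzWedhorn2020, Section (4.7)] -/
theorem twistFst_def : twistFst S X = pullback.fst X.hom (frobeniusOver S).left := rfl

/-- The structure map of `X^{(q/S)}` is the second projection (by construction of `Over.pullback`).
[cite: GortzWedhorn2020, Section (4.7)] -/
theorem frobTwist_hom : (frobTwist S X).hom = pullback.snd X.hom (frobeniusOver S).left := rfl

/-- The cartesian square of `X^{(q/S)}`: `pr_X ≫ (X → S) = (X^{(q/S)} → S) ≫ F_S`. [cite: GortzWedhorn2020, Section (4.7)] -/
@[reassoc]
theorem twistFst_comp_hom : twistFst S X ≫ X.hom = (frobTwist S X).hom ≫ (frobeniusOver S).left :=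
  pullback.condition

variable {X} in
/-- Morphisms of schemes into `X^{(q/S)}` are determined by their two projections. [cite: GortzWedhorn2020, Section (4.7)] -/
theorem twist_hom_ext {Z : Scheme.{u}} {a b : Z ⟶ (frobTwist S X).left}
    (h₁ : a ≫ twistFst S X = b ≫ twistFst S X) (h₂ : a ≫ (frobTwist S X).hom = b ≫ (frobTwist S X).hom) :
    a = b :=
  pullback.hom_ext h₁ h₂

variable {X} in
/-- `S`-morphisms into `X^{(q/S)}` are determined by their composite with `pr_X`. [cite: GortzWedhorn2020, Section (4.7)] -/
theorem frobTwist_hom_ext {T : Over S.left} {a b : T ⟶ frobTwist S X}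
    (h : a.left ≫ twistFst S X = b.left ≫ twistFst S X) : a = b := by
  ext : 1
  refine twist_hom_ext S h ?_
  rw [Over.w a, Over.w b]

/-- **The relative `q`-Frobenius `F_{X/S} : X → X^{(q/S)}`**: the `S`-morphism into `X ×_{S, F_S} S` with
components the absolute `q`-Frobenius `F_X` and the structure map `X → S` (they agree over `S` by
`absFrob_comp_hom`). [cite: SGA3I, VII_A 4.1] -/
def relFrobenius : X ⟶ frobTwist S X :=
  Over.homMk (pullback.lift (absFrob S X) X.hom (absFrob_comp_hom S X)) (pullback.lift_snd _ _ _)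

/-- `F_{X/S} ≫ pr_X = F_X`. [cite: SGA3I, VII_A 4.1] -/
@[simp, reassoc]
theorem relFrobenius_left_comp_twistFst : (relFrobenius S X).left ≫ twistFst S X = absFrob S X :=
  pullback.lift_fst _ _ _

/-- `F_{X/S}` is an `S`-morphism: followed by the structure map of `X^{(q/S)}` it is the structure map of `X`.
[cite: SGA3I, VII_A 4.1] -/
@[reassoc]
theorem relFrobenius_left_comp_hom : (relFrobenius S X).left ≫ (frobTwist S X).hom = X.hom :=
  Over.w (relFrobenius S X)

/-- `F_{X/S}` is the identity on the underlying spaces followed by the projection: `pr_X (F_{X/S} x) = x`.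
[cite: GortzWedhorn2020, Def. 4.24] -/
theorem twistFst_relFrobenius_apply (x : X.left) : twistFst S X ((relFrobenius S X).left x) = x :=
  calc twistFst S X ((relFrobenius S X).left x)
      = ((relFrobenius S X).left ≫ twistFst S X) x := (Scheme.Hom.comp_apply _ _ x).symm
    _ = absFrob S X x := by rw [relFrobenius_left_comp_twistFst]
    _ = x := rfl

variable {X}

/-- `f^{(q)} ≫ pr_Y = pr_X ≫ f` for an `S`-morphism `f : X → Y`. [cite: GortzWedhorn2020, Section (4.7)] -/
@[reassoc]
theorem pullback_map_left_comp_twistFst {Y : Over S.left} (f : X ⟶ Y) :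
    ((Over.pullback (frobeniusOver S).left).map f).left ≫ twistFst S Y = twistFst S X ≫ f.left :=
  pullback.lift_fst _ _ _

/-- For a `T`-valued point `t : T → X` over `S`, `t ≫ F_{X/S}` lies over `F_T ≫ t` (naturality of the absolute
Frobenius). [cite: SGA3I, VII_A 4.1] -/
@[reassoc]
theorem comp_relFrobenius_left_comp_twistFst {T : Over S.left} (t : T ⟶ X) :
    (t ≫ relFrobenius S X).left ≫ twistFst S X = absFrob S T ≫ t.left := by
  rw [Over.comp_left, Category.assoc, relFrobenius_left_comp_twistFst]
  exact (absFrob_comp_left S t.left).symm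

/-- **Naturality of the relative Frobenius**: `F_{X/S} ≫ f^{(q)} = f ≫ F_{Y/S}` for every `S`-morphism `f : X → Y`.
[cite: SGA3I, VII_A 4.1] -/
@[reassoc]
theorem relFrobenius_comp_map {Y : Over S.left} (f : X ⟶ Y) :
    relFrobenius S X ≫ (Over.pullback (frobeniusOver S).left).map f = f ≫ relFrobenius S Y := by
  apply frobTwist_hom_ext
  rw [Over.comp_left, Category.assoc, pullback_map_left_comp_twistFst, relFrobenius_left_comp_twistFst_assoc,
    comp_relFrobenius_left_comp_twistFst]

end Twist

/-! ## §3 The unit and the tensorator of `Over.pullback F_S` against the projection -/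

section Monoidal

variable (X : Over S.left)

/-- The projection of the twisted unit `S^{(q/S)} = S ×_{𝟙, F_S} S → S` is its structure map followed by `F_S`.
[cite: GortzWedhorn2020, Section (4.7)] -/
theorem twistFst_tensorUnit :
    twistFst S (𝟙_ (Over S.left)) = (frobTwist S (𝟙_ (Over S.left))).hom ≫ (frobeniusOver S).left :=
  (Category.comp_id (twistFst S (𝟙_ (Over S.left)))).symm.trans (twistFst_comp_hom S (𝟙_ (Over S.left)))

/-- The unit `ε : 𝟙 → 𝟙^{(q/S)}` of the monoidal structure of `Over.pullback F_S` followed by the projection is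
`F_S` (`ε` is inverse to the structure map, Mathlib `Over.ε_pullback_left`). [cite: GortzWedhorn2020, Section (4.7)] -/
@[reassoc]
theorem ε_left_comp_twistFst :
    (Functor.LaxMonoidal.ε (Over.pullback (frobeniusOver S).left)).left ≫ twistFst S (𝟙_ (Over S.left)) =
      (frobeniusOver S).left := by
  rw [Over.ε_pullback_left, twistFst_tensorUnit, frobTwist_hom]
  exact IsIso.inv_hom_id_assoc _ _

/-- On a fibre product `X ×_S X` the absolute Frobenius is determined by the two projections; here: the composite
`(F_{X/S} × F_{X/S}) ≫ μ ≫ pr_{X × X}` through the tensorator `μ` of `Over.pullback F_S` (Mathlib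
`Over.μ_pullback_left_fst_fst`, `…_fst_snd`) is the absolute `q`-Frobenius of `X ×_S X`.
[cite: SGA3I, VII_A 4.1] -/
@[reassoc]
theorem tensorHom_μ_left_comp_twistFst :
    (relFrobenius S X ⊗ₘ relFrobenius S X).left ≫
      (Functor.LaxMonoidal.μ (Over.pullback (frobeniusOver S).left) X X).left ≫ twistFst S (X ⊗ X) =
        absFrob S (X ⊗ X) := by
  have hμ₁ : (Functor.LaxMonoidal.μ (Over.pullback (frobeniusOver S).left) X X).left ≫ twistFst S (X ⊗ X) ≫
      pullback.fst X.hom X.hom = pullback.fst (frobTwist S X).hom (frobTwist S X).hom ≫ twistFst S X :=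
    Over.μ_pullback_left_fst_fst (f := (frobeniusOver S).left) X X
  have hμ₂ : (Functor.LaxMonoidal.μ (Over.pullback (frobeniusOver S).left) X X).left ≫ twistFst S (X ⊗ X) ≫
      pullback.snd X.hom X.hom = pullback.snd (frobTwist S X).hom (frobTwist S X).hom ≫ twistFst S X :=
    Over.μ_pullback_left_fst_snd (f := (frobeniusOver S).left) X X
  have hF₁ : (relFrobenius S X ⊗ₘ relFrobenius S X).left ≫ pullback.fst (frobTwist S X).hom (frobTwist S X).hom =
      pullback.fst X.hom X.hom ≫ (relFrobenius S X).left :=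
    Over.tensorHom_left_fst (frobTwist S X).hom (frobTwist S X).hom (relFrobenius S X) (relFrobenius S X)
  have hF₂ : (relFrobenius S X ⊗ₘ relFrobenius S X).left ≫ pullback.snd (frobTwist S X).hom (frobTwist S X).hom =
      pullback.snd X.hom X.hom ≫ (relFrobenius S X).left :=
    Over.tensorHom_left_snd (frobTwist S X).hom (frobTwist S X).hom (relFrobenius S X) (relFrobenius S X)
  apply pullback.hom_ext
  · rw [Category.assoc, Category.assoc, hμ₁, ← Category.assoc, hF₁, Category.assoc,
      relFrobenius_left_comp_twistFst]
    exact (absFrob_comp_left S (X := X) (T := X ⊗ X) (pullback.fst X.hom X.hom)).symm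
  · rw [Category.assoc, Category.assoc, hμ₂, ← Category.assoc, hF₂, Category.assoc,
      relFrobenius_left_comp_twistFst]
    exact (absFrob_comp_left S (X := X) (T := X ⊗ X) (pullback.snd X.hom X.hom)).symm

end Monoidal

/-! ## §4 Group schemes: `F_{G/S}` is a homomorphism -/

section Group

open scoped MonObj Obj

variable (G : Over S.left) [GrpObj G]

/-- **`F_{G/S}` respects the units**: `e_G ≫ F_{G/S} = e_{G^{(q/S)}}`, the unit of `G^{(q/S)}` being the base change
of that of `G` (compare projections to `G`: both are `F_S ≫ e_G`). [cite: SGA3I, VII_A 4.1] -/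
theorem one_comp_relFrobenius : η[G] ≫ relFrobenius S G = (η : 𝟙_ (Over S.left) ⟶ frobTwist S G) := by
  change _ = Functor.LaxMonoidal.ε (Over.pullback (frobeniusOver S).left) ≫
    (Over.pullback (frobeniusOver S).left).map η[G]
  apply frobTwist_hom_ext
  rw [comp_relFrobenius_left_comp_twistFst, Over.comp_left, Category.assoc, pullback_map_left_comp_twistFst,
    ε_left_comp_twistFst_assoc, absFrob_tensorUnit]

/-- **`F_{G/S}` respects the multiplications**: `m_G ≫ F_{G/S} = (F_{G/S} × F_{G/S}) ≫ m_{G^{(q/S)}}`, the group law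
of `G^{(q/S)}` being the base change of that of `G` (compare projections to `G`: both are `F_{G ×_S G} ≫ m_G`).
[cite: SGA3I, VII_A 4.1] -/
theorem mul_comp_relFrobenius :
    μ[G] ≫ relFrobenius S G = (relFrobenius S G ⊗ₘ relFrobenius S G) ≫ (μ : _ ⟶ frobTwist S G) := by
  change _ = _ ≫ Functor.LaxMonoidal.μ (Over.pullback (frobeniusOver S).left) G G ≫
    (Over.pullback (frobeniusOver S).left).map μ[G]
  apply frobTwist_hom_ext
  rw [comp_relFrobenius_left_comp_twistFst, Over.comp_left, Over.comp_left, Category.assoc, Category.assoc,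
    pullback_map_left_comp_twistFst, tensorHom_μ_left_comp_twistFst_assoc]

/-- **The relative Frobenius `F_{G/S} : G → G^{(q/S)}` is a homomorphism of `S`-group schemes** (for Mathlib's
transported group structure `Functor.grpObjObj` on the base change `G^{(q/S)}`; stated as a theorem — use
`haveI := isMonHom_relFrobenius S G`). [cite: SGA3I, VII_A 4.1] -/
theorem isMonHom_relFrobenius : IsMonHom (relFrobenius S G) where
  one_hom := one_comp_relFrobenius S G
  mul_hom := mul_comp_relFrobenius S G

end Group

end Literature.AlgebraicGeometry.GroupSchemes.RelFrobenius

end
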